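import Literature.Analysis.FunctionSpaces.TorusLinearisedNSDataLimit
import Literature.Analysis.FunctionSpaces.TorusLinearisedNSExistence
import Literature.Analysis.FunctionSpaces.TorusTruncationH1
import HarnessLib

/-!
# The linearised Navier–Stokes equation along a smooth field on the flat torus, IV:
# `L²` growth bounds for band-limited data extend to all data

Function-space support file (all results proved; no definitions, no named facts), sequel of
`TorusLinearisedNSDataLimit` (continuous dependence transports `L²` growth bounds to `L²`-limits of
the data).  Here the approximating data are the Fourier (Galerkin) truncations
`P_N w(a) = Torus.fourierTruncate N (w a)` of `TorusTrigPoly` (Robinson–Rodrigo–Sadowski 2016, §4.1;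
Constantin–Foias 1988, (8.3)): they are smooth, divergence free and mean-zero together with `w(a)`,
the classical linearised solutions they launch exist (`Torus.linearisedNS_exists`, `ν > 0`), and
`P_N w(a) → w(a)` in `L²` (`Torus.tendsto_lintegral_enorm_sq_fourierTruncate_sub`, the Parseval tail).

* `Torus.isDivFree_fourierTruncate_of_isSmooth` — truncations of smooth divergence-free fields are
  divergence free (the classical companion of `Torus.isDivFree_fourierTruncate`).
* `Torus.tendsto_integral_norm_sq_sub_fourierTruncate` — `∫‖v − P_N v‖² → 0` for smooth `v`
  (real-integral form of the `L²` convergence of `TorusTrigPoly`).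
* `Torus.linearisedNS_integral_norm_sq_le_of_forall_approx` — the same conclusion from ANY smooth,
  divergence-free, mean-zero data `vₙ → w(a)` in `L²` (existence + continuous dependence).
* **`Torus.linearisedNS_integral_norm_sq_le_of_forall_fourierTruncate`** — if, for every `N`, every
  classical linearised solution on `[a, b]` along `u` launched from the band-limited datum `P_N w(a)`
  obeys `∫‖W(t)‖² ≤ K ∫‖W(a)‖²`, then so does the classical solution `(w, q)` itself (mean-zero datum,
  `ν > 0`, `K ≥ 0`).

Motivation (cell `ad-ideate`, K2″ stmt-AnomalousDissipation-19696): with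
`FluidPDE/TorusLinearisedNSShearModesSuperposition` (finite superpositions of streamwise modes) this
completes the reduction of `L²` growth bounds for the linearised flow at a parallel shear to ONE
streamwise harmonic at a time: a band-limited datum is a finite superposition of streamwise modes.

## Mathlib / tree search

Tree (reused): `Torus.fourierTruncate`, `Torus.isSmooth_fourierTruncate`, `Torus.isDivFree_realTrigPoly`,
`Torus.IsDivFree.isTransversal_mFourierCoeff`, `Torus.hasZeroMean_fourierTruncate`,
`Torus.tendsto_lintegral_enorm_sq_fourierTruncate_sub`, `Torus.linearisedNS_exists`,
`Torus.linearisedNS_integral_norm_sq_le_of_tendsto`.  Mathlib: `integral_eq_lintegral_of_nonneg_ae`,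
`ENNReal.tendsto_toReal`, `ofReal_norm`.

## References

* J. C. Robinson, J. L. Rodrigo, W. Sadowski, *The Three-Dimensional Navier–Stokes Equations*, CUP 2016,
  §4.1 and Lemma 4.1 (Galerkin truncations `P_n`, `P_n u → u`). [`RobinsonRodrigoSadowski2016`]
* R. Temam, *Infinite-Dimensional Dynamical Systems in Mechanics and Physics*, 2nd ed., Springer 1997,
  Ch. VI §3.1 (3.7)–(3.11). [`Temam1997`]
-/

noncomputable section

open MeasureTheory Set Filter
open scoped InnerProductSpace ContDiff Topology ENNReal

namespace Literature.Analysis.FunctionSpaces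

namespace Torus

variable {d : Type*} [Fintype d] [DecidableEq d]

/-! ### Truncations of smooth data -/

/-- **Truncations of smooth divergence-free fields are divergence free**: `div (P_N v) = 0` for smooth
`v` with `div v = 0` (the Fourier coefficients of `v` are transversal, `k · v̂(k) = 0`). [cite: RobinsonRodrigoSadowski2016, Lemma 2.9] -/
theorem isDivFree_fourierTruncate_of_isSmooth {v : UnitAddTorus d → EuclideanSpace ℝ d}
    (hv : IsSmooth v) (hdiv : IsDivFree v) (N : ℕ) : IsDivFree (fourierTruncate N v) := by
  rw [fourierTruncate_eq]
  exact isDivFree_realTrigPoly (hdiv.isTransversal_mFourierCoeff hv (freqBall N))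

/-- **`P_N v → v` in `L²`**, real-integral form: `∫‖v − P_N v‖² → 0` for smooth `v : 𝕋^d → ℝ^d`
(the Parseval tail `∑_{|k|>N} ‖v̂(k)‖² → 0`). [cite: RobinsonRodrigoSadowski2016, Lemma 4.1, p. 74] -/
theorem tendsto_integral_norm_sq_sub_fourierTruncate {v : UnitAddTorus d → EuclideanSpace ℝ d}
    (hv : IsSmooth v) :
    Tendsto (fun N => ∫ x, ‖v x - fourierTruncate N v x‖ ^ 2) atTop (𝓝 0) := by
  have h := tendsto_lintegral_enorm_sq_fourierTruncate_sub (hv.memLp 2)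
  have h' := (ENNReal.tendsto_toReal ENNReal.zero_ne_top).comp h
  rw [ENNReal.toReal_zero] at h'
  refine h'.congr fun N => ?_
  have hmeas : AEStronglyMeasurable (fun x => ‖v x - fourierTruncate N v x‖ ^ 2) volume :=
    ((hv.continuous.sub (continuous_fourierTruncate N v)).norm.pow 2).aestronglyMeasurable
  rw [Function.comp_apply, integral_eq_lintegral_of_nonneg_ae (Eventually.of_forall fun x => by
      positivity) hmeas]
  congr 1
  refine lintegral_congr fun x => ?_
  rw [norm_sub_rev, ← ofReal_norm, ← ENNReal.ofReal_pow (norm_nonneg _)]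

/-! ### Growth bounds for band-limited data extend to all data -/

section Truncated

variable {a b ν : ℝ} {u w : ℝ → UnitAddTorus d → EuclideanSpace ℝ d} {q : ℝ → UnitAddTorus d → ℝ}

/-- **`L²` growth bounds for approximable data.** Let `u` be jointly smooth with divergence-free
slices on `[a, b] × 𝕋^d` (`a < b`, `ν > 0`), `(w, q)` a classical solution of the linearised
Navier–Stokes system along `u`, `K ≥ 0`, `t ∈ [a, b]`, and `vₙ` smooth, divergence-free, mean-zero data
with `∫‖w(a) − vₙ‖² → 0`.  If every classical linearised solution `(W, Q)` on `[a, b]` along `u` launched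
from some `vₙ` obeys `∫‖W(t)‖² ≤ K ∫‖W(a)‖²`, then `∫‖w(t)‖² ≤ K ∫‖w(a)‖²`: such solutions exist
(`Torus.linearisedNS_exists`) and continuous dependence (`Torus.linearisedNS_integral_norm_sq_le_of_tendsto`)
passes the bound to the limit. [cite: Temam1997, Ch. VI §3.1 (3.11) (well-posedness of the linearised problem)] -/
theorem linearisedNS_integral_norm_sq_le_of_forall_approx (hν : 0 < ν) (hab : a < b)
    (hu : IsSmoothSpaceTimeOn (Icc a b) u) (hudiv : ∀ t ∈ Icc a b, IsDivFree (u t))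
    (hw : IsSmoothSpaceTimeOn (Icc a b) w) (hq : IsSmoothSpaceTimeOn (Icc a b) q)
    (hwdiv : ∀ t ∈ Icc a b, IsDivFree (w t))
    (hlin : ∀ t ∈ Icc a b, ∀ x, timeDerivWithin (Icc a b) w t x + convect (u t) (w t) x +
      convect (w t) (u t) x = ν • laplacian (w t) x - gradient (q t) x)
    {v : ℕ → UnitAddTorus d → EuclideanSpace ℝ d} (hv : ∀ n, IsSmooth (v n))
    (hvdiv : ∀ n, IsDivFree (v n)) (hvmean : ∀ n, HasZeroMean (v n))
    (happrox : Tendsto (fun n => ∫ x, ‖w a x - v n x‖ ^ 2) atTop (𝓝 0))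
    {K : ℝ} (hK0 : 0 ≤ K) {t : ℝ} (ht : t ∈ Icc a b)
    (hK : ∀ (n : ℕ) (W : ℝ → UnitAddTorus d → EuclideanSpace ℝ d) (Q : ℝ → UnitAddTorus d → ℝ),
      IsSmoothSpaceTimeOn (Icc a b) W → IsSmoothSpaceTimeOn (Icc a b) Q →
      (∀ s ∈ Icc a b, IsDivFree (W s)) →
      (∀ s ∈ Icc a b, ∀ x, timeDerivWithin (Icc a b) W s x + convect (u s) (W s) x +
        convect (W s) (u s) x = ν • laplacian (W s) x - gradient (Q s) x) →
      W a = v n →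
      ∫ x, ‖W t x‖ ^ 2 ≤ K * ∫ x, ‖W a x‖ ^ 2) :
    ∫ x, ‖w t x‖ ^ 2 ≤ K * ∫ x, ‖w a x‖ ^ 2 := by
  -- classical solutions from the approximating data
  have hex : ∀ n : ℕ, ∃ (W : ℝ → UnitAddTorus d → EuclideanSpace ℝ d) (Q : ℝ → UnitAddTorus d → ℝ),
      IsSmoothSpaceTimeOn (Icc a b) W ∧ IsSmoothSpaceTimeOn (Icc a b) Q ∧
      (∀ s ∈ Icc a b, IsDivFree (W s)) ∧
      (∀ s ∈ Icc a b, ∀ x, timeDerivWithin (Icc a b) W s x + convect (u s) (W s) x +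
        convect (W s) (u s) x = ν • laplacian (W s) x - gradient (Q s) x) ∧
      W a = v n := by
    intro n
    obtain ⟨W, Q, hW, hQ, hWdiv, -, -, hWlin, hW0⟩ := linearisedNS_exists hν hab hu hudiv
      (hv n) (hvdiv n) (hvmean n)
    exact ⟨W, Q, hW, hQ, hWdiv, hWlin, hW0⟩
  choose W Q hW hQ hWdiv hWlin hW0 using hex
  refine linearisedNS_integral_norm_sq_le_of_tendsto hν.le hab hu hudiv hw hq hwdiv hlin hW hQ hWdiv
    hWlin ?_ hK0 ht fun n => hK n (W n) (Q n) (hW n) (hQ n) (hWdiv n) (hWlin n) (hW0 n)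
  exact happrox.congr fun n => by simp only [hW0 n]

/-- **`L²` growth bounds for band-limited data extend to all (mean-zero) data.** Let `u` be jointly
smooth with divergence-free slices on `[a, b] × 𝕋^d` (`a < b`, `ν > 0`), `(w, q)` a classical
solution of the linearised Navier–Stokes system along `u` with `∫ w(a) = 0`, `K ≥ 0`, `t ∈ [a, b]`.
If every classical linearised solution `(W, Q)` on `[a, b]` along `u` launched from a truncated datum
`W(a) = P_N w(a)` (`N ∈ ℕ`) obeys `∫‖W(t)‖² ≤ K ∫‖W(a)‖²`, then `∫‖w(t)‖² ≤ K ∫‖w(a)‖²`: the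
truncations are smooth, divergence free and mean-zero, and `P_N w(a) → w(a)` in `L²`
(`Torus.linearisedNS_integral_norm_sq_le_of_forall_approx`). [cite: RobinsonRodrigoSadowski2016, §4.1 Lemma 4.1 (P_n u → u); Temam 1997 Ch. VI §3.1 (3.11)] -/
theorem linearisedNS_integral_norm_sq_le_of_forall_fourierTruncate (hν : 0 < ν) (hab : a < b)
    (hu : IsSmoothSpaceTimeOn (Icc a b) u) (hudiv : ∀ t ∈ Icc a b, IsDivFree (u t))
    (hw : IsSmoothSpaceTimeOn (Icc a b) w) (hq : IsSmoothSpaceTimeOn (Icc a b) q)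
    (hwdiv : ∀ t ∈ Icc a b, IsDivFree (w t))
    (hlin : ∀ t ∈ Icc a b, ∀ x, timeDerivWithin (Icc a b) w t x + convect (u t) (w t) x +
      convect (w t) (u t) x = ν • laplacian (w t) x - gradient (q t) x)
    (hmean : HasZeroMean (w a)) {K : ℝ} (hK0 : 0 ≤ K) {t : ℝ} (ht : t ∈ Icc a b)
    (hK : ∀ (N : ℕ) (W : ℝ → UnitAddTorus d → EuclideanSpace ℝ d) (Q : ℝ → UnitAddTorus d → ℝ),
      IsSmoothSpaceTimeOn (Icc a b) W → IsSmoothSpaceTimeOn (Icc a b) Q →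
      (∀ s ∈ Icc a b, IsDivFree (W s)) →
      (∀ s ∈ Icc a b, ∀ x, timeDerivWithin (Icc a b) W s x + convect (u s) (W s) x +
        convect (W s) (u s) x = ν • laplacian (W s) x - gradient (Q s) x) →
      W a = fourierTruncate N (w a) →
      ∫ x, ‖W t x‖ ^ 2 ≤ K * ∫ x, ‖W a x‖ ^ 2) :
    ∫ x, ‖w t x‖ ^ 2 ≤ K * ∫ x, ‖w a x‖ ^ 2 := by
  have ha : a ∈ Icc a b := left_mem_Icc.2 hab.le
  have hwa : IsSmooth (w a) := hw.isSmooth_slice ha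
  exact linearisedNS_integral_norm_sq_le_of_forall_approx hν hab hu hudiv hw hq hwdiv hlin
    (fun N => isSmooth_fourierTruncate N (w a))
    (fun N => isDivFree_fourierTruncate_of_isSmooth hwa (hwdiv a ha) N)
    (fun N => hasZeroMean_fourierTruncate hwa.integrable hmean N)
    (tendsto_integral_norm_sq_sub_fourierTruncate hwa) hK0 ht hK

end Truncated

end Torus

end Literature.Analysis.FunctionSpaces

end
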